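import Summits.NavierStokesRegularity.NavierStokesRegularity.Theorems.OddMorawetzLocal.Negative.OddMorawetzLocalRefutationDefsIV
import Summits.NavierStokesRegularity.NavierStokesRegularity.Theorems.OddMorawetzOddMorawetzLocalCubicWeightSplit
import Summits.NavierStokesRegularity.NavierStokesRegularity.Theorems.OddMorawetzMorawetzKillsTypeICubicJetExpansion
import Summits.NavierStokesRegularity.NavierStokesRegularity.Theorems.OddMorawetzOddMorawetzLocalActMatrixSemantics
import Summits.NavierStokesRegularity.NavierStokesRegularity.Theorems.OddMorawetzOddMorawetzLocalIdxComplete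
import Summits.NavierStokesRegularity.NavierStokesRegularity.Theorems.OddMorawetzOddMorawetzLocalNormCast
import HarnessLib

/-!
# Crux `OddMorawetzLocal` (stmt-NavierStokesRegularity-1376) — structure of a certificate density:
  `m = densV k τ` on symmetric jets

Stub `structure_densV` of the refutation skeleton of `OddMorawetzLocal` (line `registered`, lead c1).  Mathlib
(multilinear / `Finset` bookkeeping) on top of the landed `cubic_weightSplit` (`…CubicWeightSplit`: the weight-`k`
part of a cubic jet form), `CubicJetExpansion.coordinate_expansion` (`…CubicJetExpansion`: coordinates of a
multilinear map `ℝ³ × ⋯ × ℝ³ → ℝ³`), `evalA_polyOfV` (`…ActMatrixSemantics`), `mem_idx_of_canonical`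
(`…IdxComplete`), the sorting lemmas of `…IdxCompleteSort` and `prod_map_sortVars` (`…NormCast`); no named facts;
nothing is defined.

A certificate density of the crux is a smooth `m : Jet3 → ℝ`, cubic (`m (μ • z) = μ ^ 3 * m z`) and of derivative
weight `k` under the jet dilations `(z₀, s • z₁, s² • z₂, s³ • z₃)`.  This file puts `m` into the finite
coefficient language of the refutation: on the symmetric jets `symmJets` (second and third slots symmetric — the
jets of smooth fields) `m = densV k τ` for a real coefficient vector `τ : V k` on the monomial basis `idx k` of the
canonical cubic monomials of weight `k` in the jet coordinates `JVar.coord (a, l)`.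

Proof.
* `cubic_weightSplit`: `6 * m z = ∑_{a + b + c = k} D³m(0)[ι_a z, ι_b z, ι_c z]` with `ι_n z` the pure jet of
  order `n` of `z`.
* `pure_jet_expansion`: each pure jet is a finite combination `ι_n z = ∑_{(i, j)} coord (i, sort j) z • B (i, j)` of
  CONSTANT jets `B (i, j)` (`i : Fin 3`, `j : Fin n → Fin 3`) with the jet coordinates as coefficients
  (`coordinate_expansion` slot by slot; on a symmetric jet the value `zₙ (e_{j 0}, …)ᵢ` is the SORTED coordinate
  `(i, sort j)` — `coord_sortIdx_one/two/three`, adapted from `…ActSemantics`).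
* trilinearity (`tri_expand`): `D³m(0)[ι_a z, ι_b z, ι_c z] = ∑ (constant) · coord u z · coord v z · coord w z`
  over triples of sorted variables of orders `a, b, c`, `a + b + c = k`.
* `monomial_eq_densV`: each such product is `densV k τ` for the indicator vector `τ` of the basis monomial
  `sortVars [u, v, w] ∈ idx k` (`mem_idx_of_canonical`, `prod_map_sortVars`), and the functions representable as
  `densV k τ` on `symmJets` are closed under finite sums and scalars (`densV` is linear in `τ`).
-/

noncomputable section

set_option linter.dupNamespace false
set_option autoImplicit false

namespace Summit.NavierStokesRegularity.NavierStokesRegularity.Theorems.OddMorawetz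

/-! ### `densV` is linear in the coefficient vector -/

/-- `densV` unfolded: `densV k τ z = ∑ i, τ i · Π_{v ∈ idx_i} coord v z`. -/
private theorem densV_apply (k : ℕ) (τ : V k) (z : Jet3) :
    densV k τ z = ∑ i, τ i * (((idx k).get i).map fun v => JVar.coord v z).prod :=
  evalA_polyOfV k τ _

/-- `densV` is homogeneous in `τ`. -/
private theorem densV_smul (k : ℕ) (c : ℝ) (τ : V k) (z : Jet3) : densV k (c • τ) z = c * densV k τ z := by
  rw [densV_apply, densV_apply, Finset.mul_sum]
  exact Finset.sum_congr rfl fun i _ => by rw [Pi.smul_apply, smul_eq_mul, mul_assoc]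

/-- `densV` is additive in `τ` (finite sums). -/
private theorem densV_sum {ι : Type} (k : ℕ) (s : Finset ι) (τ : ι → V k) (z : Jet3) :
    densV k (∑ t ∈ s, τ t) z = ∑ t ∈ s, densV k (τ t) z := by
  simp only [densV_apply, Finset.sum_apply, Finset.sum_mul]
  exact Finset.sum_comm

/-- `densV k 0 = 0`. -/
private theorem densV_zero (k : ℕ) (z : Jet3) : densV k 0 z = 0 := by
  simp [densV_apply]

/-- Functions representable as `densV k τ` on `symmJets` are closed under finite sums. -/
private theorem exists_densV_sum {ι : Type} [Fintype ι] (k : ℕ) (f : ι → Jet3 → ℝ)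
    (h : ∀ t, ∃ τ : V k, ∀ z : Jet3, z ∈ symmJets → f t z = densV k τ z) :
    ∃ τ : V k, ∀ z : Jet3, z ∈ symmJets → (∑ t, f t z) = densV k τ z := by
  choose τ hτ using h
  exact ⟨∑ t, τ t, fun z hz => by rw [densV_sum]; exact Finset.sum_congr rfl fun t _ => hτ t z hz⟩

/-- Functions representable as `densV k τ` on `symmJets` are closed under scalars. -/
private theorem exists_densV_const_mul (k : ℕ) (c : ℝ) (f : Jet3 → ℝ)
    (h : ∃ τ : V k, ∀ z : Jet3, z ∈ symmJets → f z = densV k τ z) :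
    ∃ τ : V k, ∀ z : Jet3, z ∈ symmJets → c * f z = densV k τ z := by
  obtain ⟨τ, hτ⟩ := h
  exact ⟨c • τ, fun z hz => by rw [densV_smul, hτ z hz]⟩

/-! ### Monomials of canonical variables are basis densities -/

/-- `sortIdx` is idempotent. -/
private theorem sortIdx_sortIdx_eq (l : List (Fin 3)) : sortIdx (sortIdx l) = sortIdx l :=
  (sortIdx_eq_self_iff _).2 (by rw [sortIdx_eq_insertionSort]; exact List.pairwise_insertionSort _ _)

/-- Sorting a list of `n` indices gives a list of length `n`. -/
private theorem length_sortIdx_ofFn {n : ℕ} (j : Fin n → Fin 3) :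
    (sortIdx (List.ofFn j)).length = n := by
  rw [sortIdx_eq_insertionSort, List.length_insertionSort, List.length_ofFn]

/-- **A cubic monomial in canonical variables of total weight `k` is a basis density**: the product
`coord u · coord v · coord w` (sorted index lists of lengths `≤ 3` summing to `k`) is `densV k τ` for the indicator
vector `τ` of the basis monomial `sortVars [u, v, w] ∈ idx k`. -/
private theorem monomial_eq_densV (k : ℕ) (u v w : JVar) (hu : sortIdx u.2 = u.2 ∧ u.2.length ≤ 3)
    (hv : sortIdx v.2 = v.2 ∧ v.2.length ≤ 3) (hw : sortIdx w.2 = w.2 ∧ w.2.length ≤ 3)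
    (hk : u.2.length + v.2.length + w.2.length = k) :
    ∃ τ : V k, ∀ z : Jet3, JVar.coord u z * JVar.coord v z * JVar.coord w z = densV k τ z := by
  classical
  have hp := perm_sortVars [u, v, w]
  have hmem : sortVars [u, v, w] ∈ idx k := by
    refine mem_idx_of_canonical (sortVars_sortVars _) (by simp [hp.length_eq]) (fun x hx => ?_) ?_
    · have hx' : x ∈ [u, v, w] := hp.subset hx
      simp only [List.mem_cons, List.not_mem_nil, or_false] at hx'
      rcases hx' with rfl | rfl | rfl
      exacts [hu, hv, hw]
    · unfold monoWeight
      rw [(hp.map _).sum_eq]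
      simp only [List.map_cons, List.map_nil, List.sum_cons, List.sum_nil]
      omega
  obtain ⟨ι, hι⟩ := List.get_of_mem hmem
  refine ⟨fun i => if i = ι then 1 else 0, fun z => ?_⟩
  rw [densV_apply]
  simp only [ite_mul, one_mul, zero_mul, Finset.sum_ite_eq', Finset.mem_univ, if_true]
  rw [hι, prod_map_sortVars]
  simp [mul_assoc]

/-! ### Trilinear expansion -/

/-- Full expansion of a continuous trilinear form on three finite combinations:
`T (∑ c₁ • f₁, ∑ c₂ • f₂, ∑ c₃ • f₃) = ∑∑∑ T (f₁, f₂, f₃) · (c₁ c₂ c₃)`. -/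
private theorem tri_expand (T : Jet3 [×3]→L[ℝ] ℝ) {α β γ : Type} [Fintype α] [Fintype β]
    [Fintype γ] (c₁ : α → ℝ) (f₁ : α → Jet3) (c₂ : β → ℝ) (f₂ : β → Jet3) (c₃ : γ → ℝ)
    (f₃ : γ → Jet3) :
    T ![∑ p, c₁ p • f₁ p, ∑ q, c₂ q • f₂ q, ∑ r, c₃ r • f₃ r] =
      ∑ p, ∑ q, ∑ r, T ![f₁ p, f₂ q, f₃ r] * (c₁ p * c₂ q * c₃ r) := by
  rw [map_vec3_sum_smul_fst]
  refine Finset.sum_congr rfl fun p _ => ?_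
  rw [map_vec3_sum_smul_snd, Finset.mul_sum]
  refine Finset.sum_congr rfl fun q _ => ?_
  rw [map_vec3_sum_smul_thd, Finset.mul_sum, Finset.mul_sum]
  refine Finset.sum_congr rfl fun r _ => ?_
  ring

/-! ### Sorted coordinates of symmetric jets (adapted from `…OddMorawetzOddMorawetzLocalActSemantics`) -/

-- adapted from …Theorems/OddMorawetzOddMorawetzLocalActSemantics.lean (private there)
/-- First slot: `z₁(e_{J 0})_b` is the coordinate `(b, [J 0])`. -/
private theorem coord_sortIdx_one' (z : Jet3) (J : Fin 1 → Fin 3) (b : Fin 3) :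
    z.2.1 (fun s => stdVec (J s)) b = JVar.coord (b, sortIdx (List.ofFn J)) z := by
  have hJ : List.ofFn J = [J 0] := by simp [List.ofFn_succ]
  have hw : (fun s => stdVec (J s)) = fun _ => stdVec (J 0) := by
    funext s
    fin_cases s
    rfl
  rw [hJ, hw]
  simp [sortIdx, insertIdx, JVar.coord]

-- adapted from …Theorems/OddMorawetzOddMorawetzLocalActSemantics.lean (private there)
/-- Second slot (symmetric): `z₂(e_{J 0}, e_{J 1})_b` is the coordinate `(b, sort J)`. -/
private theorem coord_sortIdx_two' (z : Jet3)
    (hz2 : ∀ (w : Fin 2 → EuclideanSpace ℝ (Fin 3)) (σ : Equiv.Perm (Fin 2)), z.2.2.1 (w ∘ σ) = z.2.2.1 w)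
    (J : Fin 2 → Fin 3) (b : Fin 3) :
    z.2.2.1 (fun s => stdVec (J s)) b = JVar.coord (b, sortIdx (List.ofFn J)) z := by
  have hJ : List.ofFn J = [J 0, J 1] := by simp [List.ofFn_succ]
  -- a permutation of the slots does not change the value
  have hperm : ∀ (σ : Equiv.Perm (Fin 2)) (w' : Fin 2 → EuclideanSpace ℝ (Fin 3)),
      (∀ s, stdVec (J (σ s)) = w' s) → z.2.2.1 (fun s => stdVec (J s)) = z.2.2.1 w' := by
    intro σ w' h
    rw [← hz2 _ σ]
    exact congrArg _ (funext h)
  rw [hJ]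
  simp only [sortIdx, List.foldr, insertIdx]
  split_ifs
  · rw [hperm (Equiv.swap 0 1) ![stdVec (J 1), stdVec (J 0)] (fun s => by fin_cases s <;> rfl)]
    simp [JVar.coord]
  · rw [hperm 1 ![stdVec (J 0), stdVec (J 1)] (fun s => by fin_cases s <;> rfl)]
    simp [JVar.coord]

-- adapted from …Theorems/OddMorawetzOddMorawetzLocalActSemantics.lean (private there)
/-- Third slot (symmetric): `z₃(e_{J 0}, e_{J 1}, e_{J 2})_b` is the coordinate `(b, sort J)`. -/
private theorem coord_sortIdx_three' (z : Jet3)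
    (hz3 : ∀ (w : Fin 3 → EuclideanSpace ℝ (Fin 3)) (σ : Equiv.Perm (Fin 3)), z.2.2.2 (w ∘ σ) = z.2.2.2 w)
    (J : Fin 3 → Fin 3) (b : Fin 3) :
    z.2.2.2 (fun s => stdVec (J s)) b = JVar.coord (b, sortIdx (List.ofFn J)) z := by
  have hJ : List.ofFn J = [J 0, J 1, J 2] := by simp [List.ofFn_succ]
  have hperm : ∀ (σ : Equiv.Perm (Fin 3)) (w' : Fin 3 → EuclideanSpace ℝ (Fin 3)),
      (∀ s, stdVec (J (σ s)) = w' s) → z.2.2.2 (fun s => stdVec (J s)) = z.2.2.2 w' := by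
    intro σ w' h
    rw [← hz3 _ σ]
    exact congrArg _ (funext h)
  rw [hJ]
  simp only [sortIdx, List.foldr, insertIdx]
  split_ifs <;> simp only [insertIdx] <;> split_ifs
  · rw [hperm (Equiv.swap 0 2) ![stdVec (J 2), stdVec (J 1), stdVec (J 0)]
      (fun s => by fin_cases s <;> rfl)]
    simp [JVar.coord]
  · rw [hperm ((Equiv.swap 0 1).trans (Equiv.swap 1 2)) ![stdVec (J 2), stdVec (J 0), stdVec (J 1)]
      (fun s => by fin_cases s <;> rfl)]
    simp [JVar.coord]
  · rw [hperm (Equiv.swap 1 2) ![stdVec (J 0), stdVec (J 2), stdVec (J 1)]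
      (fun s => by fin_cases s <;> rfl)]
    simp [JVar.coord]
  · rw [hperm ((Equiv.swap 1 2).trans (Equiv.swap 0 1)) ![stdVec (J 1), stdVec (J 2), stdVec (J 0)]
      (fun s => by fin_cases s <;> rfl)]
    simp [JVar.coord]
  · rw [hperm (Equiv.swap 0 1) ![stdVec (J 1), stdVec (J 0), stdVec (J 2)]
      (fun s => by fin_cases s <;> rfl)]
    simp [JVar.coord]
  · rw [hperm 1 ![stdVec (J 0), stdVec (J 1), stdVec (J 2)] (fun s => by fin_cases s <;> rfl)]
    simp [JVar.coord]

/-! ### Pure jets in coordinates -/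

/-- Order `0`: `(z₀, 0, 0, 0) = ∑ᵢ coord (i, []) z • (eᵢ, 0, 0, 0)` (indexed by `Fin 3 × (Fin 0 → Fin 3)` for
uniformity). -/
private theorem pure_jet_zero (z : Jet3) :
    ((z.1, 0, 0, 0) : Jet3) = ∑ p : Fin 3 × (Fin 0 → Fin 3),
      JVar.coord (p.1, sortIdx (List.ofFn p.2)) z • ((stdVec p.1, 0, 0, 0) : Jet3) := by
  have hexp : z.1 = ∑ i : Fin 3, z.1 i • stdVec i := by
    conv_lhs => rw [← (EuclideanSpace.basisFun (Fin 3) ℝ).sum_repr z.1]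
    simp
  have hL : ∀ x : EuclideanSpace ℝ (Fin 3), ((x, 0, 0, 0) : Jet3) = ContinuousLinearMap.inl ℝ _ _ x := fun x => rfl
  have hc : ∀ p : Fin 3 × (Fin 0 → Fin 3), JVar.coord (p.1, sortIdx (List.ofFn p.2)) z = z.1 p.1 := by
    intro p
    simp [sortIdx, JVar.coord]
  simp only [hL, hc]
  conv_lhs => rw [hexp]
  rw [map_sum, Fintype.sum_prod_type]
  refine Finset.sum_congr rfl fun i _ => ?_
  rw [map_smul, Fintype.sum_unique]

/-- Order `1`: `(0, z₁, 0, 0) = ∑ coord (i, [j 0]) z • (0, E_{i,j}, 0, 0)`. -/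
private theorem pure_jet_one (z : Jet3) :
    ((0, z.2.1, 0, 0) : Jet3) = ∑ p : Fin 3 × (Fin 1 → Fin 3),
      JVar.coord (p.1, sortIdx (List.ofFn p.2)) z •
        ((0, (ContinuousMultilinearMap.mkPiRing ℝ (Fin 1) (stdVec p.1)).compContinuousLinearMap
          (fun s => EuclideanSpace.proj (p.2 s)), 0, 0) : Jet3) := by
  have hL : ∀ x : EuclideanSpace ℝ (Fin 3) [×1]→L[ℝ] EuclideanSpace ℝ (Fin 3), ((0, x, 0, 0) : Jet3) =
      ((ContinuousLinearMap.inr ℝ (EuclideanSpace ℝ (Fin 3)) _).comp (ContinuousLinearMap.inl ℝ _ _)) x :=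
    fun x => rfl
  simp only [hL]
  conv_lhs => rw [CubicJetExpansion.coordinate_expansion 1 z.2.1]
  rw [map_sum, Fintype.sum_prod_type]
  refine Finset.sum_congr rfl fun i _ => ?_
  rw [map_sum]
  refine Finset.sum_congr rfl fun j _ => ?_
  rw [map_smul, coord_sortIdx_one']

/-- Order `2` (symmetric slot): `(0, 0, z₂, 0) = ∑ coord (i, sort j) z • (0, 0, E_{i,j}, 0)`. -/
private theorem pure_jet_two (z : Jet3)
    (hz2 : ∀ (w : Fin 2 → EuclideanSpace ℝ (Fin 3)) (σ : Equiv.Perm (Fin 2)), z.2.2.1 (w ∘ σ) = z.2.2.1 w) :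
    ((0, 0, z.2.2.1, 0) : Jet3) = ∑ p : Fin 3 × (Fin 2 → Fin 3),
      JVar.coord (p.1, sortIdx (List.ofFn p.2)) z •
        ((0, 0, (ContinuousMultilinearMap.mkPiRing ℝ (Fin 2) (stdVec p.1)).compContinuousLinearMap
          (fun s => EuclideanSpace.proj (p.2 s)), 0) : Jet3) := by
  have hL : ∀ x : EuclideanSpace ℝ (Fin 3) [×2]→L[ℝ] EuclideanSpace ℝ (Fin 3), ((0, 0, x, 0) : Jet3) =
      ((ContinuousLinearMap.inr ℝ (EuclideanSpace ℝ (Fin 3)) _).comp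
        ((ContinuousLinearMap.inr ℝ (EuclideanSpace ℝ (Fin 3) [×1]→L[ℝ] EuclideanSpace ℝ (Fin 3)) _).comp
          (ContinuousLinearMap.inl ℝ _ _))) x :=
    fun x => rfl
  simp only [hL]
  conv_lhs => rw [CubicJetExpansion.coordinate_expansion 2 z.2.2.1]
  rw [map_sum, Fintype.sum_prod_type]
  refine Finset.sum_congr rfl fun i _ => ?_
  rw [map_sum]
  refine Finset.sum_congr rfl fun j _ => ?_
  rw [map_smul, coord_sortIdx_two' z hz2]

/-- Order `3` (symmetric slot): `(0, 0, 0, z₃) = ∑ coord (i, sort j) z • (0, 0, 0, E_{i,j})`. -/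
private theorem pure_jet_three (z : Jet3)
    (hz3 : ∀ (w : Fin 3 → EuclideanSpace ℝ (Fin 3)) (σ : Equiv.Perm (Fin 3)), z.2.2.2 (w ∘ σ) = z.2.2.2 w) :
    ((0, 0, 0, z.2.2.2) : Jet3) = ∑ p : Fin 3 × (Fin 3 → Fin 3),
      JVar.coord (p.1, sortIdx (List.ofFn p.2)) z •
        ((0, 0, 0, (ContinuousMultilinearMap.mkPiRing ℝ (Fin 3) (stdVec p.1)).compContinuousLinearMap
          (fun s => EuclideanSpace.proj (p.2 s))) : Jet3) := by
  have hL : ∀ x : EuclideanSpace ℝ (Fin 3) [×3]→L[ℝ] EuclideanSpace ℝ (Fin 3), ((0, 0, 0, x) : Jet3) =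
      ((ContinuousLinearMap.inr ℝ (EuclideanSpace ℝ (Fin 3)) _).comp
        ((ContinuousLinearMap.inr ℝ (EuclideanSpace ℝ (Fin 3) [×1]→L[ℝ] EuclideanSpace ℝ (Fin 3)) _).comp
          (ContinuousLinearMap.inr ℝ (EuclideanSpace ℝ (Fin 3) [×2]→L[ℝ] EuclideanSpace ℝ (Fin 3)) _))) x :=
    fun x => rfl
  simp only [hL]
  conv_lhs => rw [CubicJetExpansion.coordinate_expansion 3 z.2.2.2]
  rw [map_sum, Fintype.sum_prod_type]
  refine Finset.sum_congr rfl fun i _ => ?_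
  rw [map_sum]
  refine Finset.sum_congr rfl fun j _ => ?_
  rw [map_smul, coord_sortIdx_three' z hz3]

/-- **Pure jets in coordinates.** For each order `n ≤ 3` there are constant jets `B (i, j)` (`i : Fin 3`,
`j : Fin n → Fin 3`) such that on every symmetric jet `z` the pure jet of order `n` of `z` is
`∑_{(i, j)} coord (i, sort j) z • B (i, j)`. -/
private theorem pure_jet_expansion (n : Fin 4) :
    ∃ B : Fin 3 × (Fin n → Fin 3) → Jet3, ∀ z : Jet3, z ∈ symmJets →
    (![((z.1, 0, 0, 0) : Jet3), (0, z.2.1, 0, 0), (0, 0, z.2.2.1, 0), (0, 0, 0, z.2.2.2)] n) =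
      ∑ p : Fin 3 × (Fin n → Fin 3), JVar.coord (p.1, sortIdx (List.ofFn p.2)) z • B p := by
  fin_cases n
  · exact ⟨_, fun z _ => pure_jet_zero z⟩
  · exact ⟨_, fun z _ => pure_jet_one z⟩
  · exact ⟨_, fun z hz => pure_jet_two z hz.1⟩
  · exact ⟨_, fun z hz => pure_jet_three z hz.2⟩

/-! ### Blocks of the third derivative are basis densities -/

/-- **A pure block is a basis density.** If three jet-valued maps expand on `symmJets` in sorted coordinates of
orders `na, nb, nc ≤ 3` with `na + nb + nc = k`, then `z ↦ T (Pa z, Pb z, Pc z)` is `densV k τ` on `symmJets` for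
some coefficient vector `τ` (trilinear expansion, then `monomial_eq_densV` term by term). -/
private theorem block_eq_densV (T : Jet3 [×3]→L[ℝ] ℝ) (k : ℕ) {na nb nc : ℕ} (hk : na + nb + nc = k)
    (hna : na ≤ 3) (hnb : nb ≤ 3) (hnc : nc ≤ 3) (Pa Pb Pc : Jet3 → Jet3)
    (Ba : Fin 3 × (Fin na → Fin 3) → Jet3)
    (Bb : Fin 3 × (Fin nb → Fin 3) → Jet3) (Bc : Fin 3 × (Fin nc → Fin 3) → Jet3)
    (hPa : ∀ z : Jet3, z ∈ symmJets → Pa z = ∑ p, JVar.coord (p.1, sortIdx (List.ofFn p.2)) z • Ba p)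
    (hPb : ∀ z : Jet3, z ∈ symmJets → Pb z = ∑ p, JVar.coord (p.1, sortIdx (List.ofFn p.2)) z • Bb p)
    (hPc : ∀ z : Jet3, z ∈ symmJets → Pc z = ∑ p, JVar.coord (p.1, sortIdx (List.ofFn p.2)) z • Bc p) :
    ∃ τ : V k, ∀ z : Jet3, z ∈ symmJets → T ![Pa z, Pb z, Pc z] = densV k τ z := by
  have hexp : ∀ z : Jet3, z ∈ symmJets → T ![Pa z, Pb z, Pc z] =
      ∑ p : Fin 3 × (Fin na → Fin 3), ∑ q : Fin 3 × (Fin nb → Fin 3), ∑ r : Fin 3 × (Fin nc → Fin 3),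
        T ![Ba p, Bb q, Bc r] * (JVar.coord (p.1, sortIdx (List.ofFn p.2)) z *
          JVar.coord (q.1, sortIdx (List.ofFn q.2)) z * JVar.coord (r.1, sortIdx (List.ofFn r.2)) z) := by
    intro z hz
    rw [hPa z hz, hPb z hz, hPc z hz, tri_expand]
  obtain ⟨τ, hτ⟩ : ∃ τ : V k, ∀ z : Jet3, z ∈ symmJets →
      (∑ p : Fin 3 × (Fin na → Fin 3), ∑ q : Fin 3 × (Fin nb → Fin 3), ∑ r : Fin 3 × (Fin nc → Fin 3),
        T ![Ba p, Bb q, Bc r] * (JVar.coord (p.1, sortIdx (List.ofFn p.2)) z *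
          JVar.coord (q.1, sortIdx (List.ofFn q.2)) z * JVar.coord (r.1, sortIdx (List.ofFn r.2)) z)) =
      densV k τ z := by
    refine exists_densV_sum k _ fun p => exists_densV_sum k _ fun q => exists_densV_sum k _ fun r =>
      exists_densV_const_mul k _ _ ?_
    obtain ⟨τ, hτ⟩ := monomial_eq_densV k (p.1, sortIdx (List.ofFn p.2)) (q.1, sortIdx (List.ofFn q.2))
      (r.1, sortIdx (List.ofFn r.2)) ⟨sortIdx_sortIdx_eq _, by rw [length_sortIdx_ofFn]; exact hna⟩
      ⟨sortIdx_sortIdx_eq _, by rw [length_sortIdx_ofFn]; exact hnb⟩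
      ⟨sortIdx_sortIdx_eq _, by rw [length_sortIdx_ofFn]; exact hnc⟩
      (by simp only [length_sortIdx_ofFn]; exact hk)
    exact ⟨τ, fun z _ => hτ z⟩
  exact ⟨τ, fun z hz => (hexp z hz).trans (hτ z hz)⟩

/-! ### The stub -/

/-- **Stub `structure_densV` (refutation of crux `OddMorawetzLocal`).** A smooth density `m` on 3-jets which is
a cubic form (`m (μ • z) = μ ^ 3 * m z`) of derivative weight `k` under the jet dilations
`(z₀, s • z₁, s² • z₂, s³ • z₃)`, `s > 0`, is on the symmetric jets (`symmJets`: second and third slots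
symmetric — the jets of smooth fields) the density `densV k τ` of a real coefficient vector `τ` on the monomial
basis `idx k` of canonical cubic monomials of weight `k` in the jet coordinates. -/
theorem structure_densV (k : ℕ) {m : Jet3 → ℝ} (hm : ContDiff ℝ (⊤ : ℕ∞) m)
    (hcub : ∀ (μ : ℝ) (z : Jet3), m (μ • z) = μ ^ 3 * m z)
    (hwt : ∀ s : ℝ, 0 < s → ∀ (z₀ : EuclideanSpace ℝ (Fin 3))
      (z₁ : EuclideanSpace ℝ (Fin 3) [×1]→L[ℝ] EuclideanSpace ℝ (Fin 3))
      (z₂ : EuclideanSpace ℝ (Fin 3) [×2]→L[ℝ] EuclideanSpace ℝ (Fin 3))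
      (z₃ : EuclideanSpace ℝ (Fin 3) [×3]→L[ℝ] EuclideanSpace ℝ (Fin 3)),
      m (z₀, s • z₁, (s ^ 2) • z₂, (s ^ 3) • z₃) = s ^ k * m (z₀, z₁, z₂, z₃)) :
    ∃ τ : V k, ∀ z : Jet3, z ∈ symmJets → m z = densV k τ z := by
  -- each block of the weight split is a basis density on `symmJets`
  have hterm : ∀ a b c : Fin 4, ∃ τ : V k, ∀ z : Jet3, z ∈ symmJets →
      (if a.val + b.val + c.val = k then
        iteratedFDeriv ℝ 3 m 0
          ![(![((z.1, 0, 0, 0) : Jet3), (0, z.2.1, 0, 0), (0, 0, z.2.2.1, 0), (0, 0, 0, z.2.2.2)] a),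
            (![((z.1, 0, 0, 0) : Jet3), (0, z.2.1, 0, 0), (0, 0, z.2.2.1, 0), (0, 0, 0, z.2.2.2)] b),
            (![((z.1, 0, 0, 0) : Jet3), (0, z.2.1, 0, 0), (0, 0, z.2.2.1, 0), (0, 0, 0, z.2.2.2)] c)]
      else 0) = densV k τ z := by
    intro a b c
    by_cases h : a.val + b.val + c.val = k
    · obtain ⟨Ba, hBa⟩ := pure_jet_expansion a
      obtain ⟨Bb, hBb⟩ := pure_jet_expansion b
      obtain ⟨Bc, hBc⟩ := pure_jet_expansion c
      obtain ⟨τ, hτ⟩ := block_eq_densV (iteratedFDeriv ℝ 3 m 0) k h (by omega) (by omega) (by omega)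
        _ _ _ Ba Bb Bc hBa hBb hBc
      exact ⟨τ, fun z hz => by rw [if_pos h]; exact hτ z hz⟩
    · exact ⟨0, fun z _ => by rw [if_neg h, densV_zero]⟩
  obtain ⟨τ, hτ⟩ := exists_densV_sum k _ fun a => exists_densV_sum k _ fun b =>
    exists_densV_sum k _ fun c => hterm a b c
  refine ⟨(6 : ℝ)⁻¹ • τ, fun z hz => ?_⟩
  rw [densV_smul, ← hτ z hz, ← cubic_weightSplit k hm hcub hwt z]
  ring

end Summit.NavierStokesRegularity.NavierStokesRegularity.Theorems.OddMorawetz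

end
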